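import Summits.Ventures.PercRepro.RankLevelSetLevelSevenQuart
import Summits.Ventures.PercRepro.RankLevelSetLevelSixRowsNineToFifteen
import Summits.Ventures.PercRepro.S3SixWindow

/-!
# PercRepro — THE ROW `73` OF LEVEL `7`: C-025 AT `q = 7` FOR EVERY FINITE MATROID AND EVERY `p ≥ 73` (p8, gen 18; a feeder
for S4 — the top of the `q = 7` window, from `74`)

p2 g34's THEOREM C₇ (`c025_seven_large_quart'`, RankLevelSetLevelSevenQuart: level `7` for every `p ≥ 74`) reaches `74` through
night-1's threshold wrapper `rls_succ_large 6 7 73`, which spends one rank: the `e`-free core at rank `p ≥ 73` gives level `7`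
at `p ≥ 74`. The per-rank wrapper `rls_succ_large_at` (p8 g0, S3SixWindow) spends none: level `7` AT rank `p₀` follows from
level `6` at `p₀ − 1` (the whole level-`6` row `c025_six_all`, every `p ≥ 8`), level `7` at corank `≤ 7` (`U = ∅` or Theorem M)
and the `e`-free core AT rank `p₀`, corank `≥ 8`. At `p₀ = 73` the core is already in the tree — p2's cells
`c025_core_seven_bounded_corank_quart` (`8 ≤ d ≤ 90`) and `c025_core_seven_large_corank` (`d ≥ 91`) at `p = 73` — so the
row `73` needs no new cell.
* **`c025_seven_at_seventy_three`** — level `7` at rank `73`, every finite matroid;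
* **`c025_seven_large_seventy_three`** — level `7` for every `p ≥ 73`; **`c025_seven_seventy_three`** the same in the `C025` body.
Axioms: standard.
-/

open scoped Matroid

namespace PercRepro

namespace ThmN

variable {α : Type}

/-- **Level `7` at rank `73`, every finite matroid**: `rls_succ_large_at 6 7 73` on level `6` at `72` (`c025_six_all`), the
coranks `≤ 7` (`U = ∅` or Theorem M) and p2's core cells at `p = 73` (`c025_core_seven_bounded_corank_quart` for
`8 ≤ d ≤ 90`, `c025_core_seven_large_corank` for `d ≥ 91`). -/
theorem c025_seven_at_seventy_three (M : Matroid α) [M.Finite] : RLS M 73 7 := by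
  refine rls_succ_large_at (α := α) 6 7 73 (by norm_num) (fun M _ => c025_six_all M 72 (by norm_num)) ?_ ?_ M
  · -- corank `≤ 7`: `U = ∅` or Theorem M
    intro M _ hn
    rcases Nat.lt_or_ge M.E.ncard (73 + 7) with h | h
    · exact RLS_of_ncard_lt M h
    · exact RLS_of_ncard_eq M (by omega)
  · -- the core at corank `≥ 8`: p2's cells at `p = 73`
    intro M _ hR hbig hfree
    rcases Nat.lt_or_ge M.E.ncard (73 + 91) with h | h
    · exact c025_core_seven_bounded_corank_quart M 73 (M.E.ncard - 73) (le_refl _) (by omega) (by omega) hR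
        (by omega) hfree
    · exact c025_core_seven_large_corank M 73 (le_refl _) hR (by omega) hfree

/-- **THEOREM C₇ AT `73`, UNCONDITIONAL OVER THE TREE**: every finite matroid satisfies C-025 at level `7` for every
`p ≥ 73` — the row `73` by `c025_seven_at_seventy_three`, the rows `≥ 74` by p2's `c025_seven_large_quart'`. -/
theorem c025_seven_large_seventy_three (M : Matroid α) [M.Finite] (p : ℕ) (hp : 73 ≤ p) : RLS M p 7 := by
  rcases Nat.lt_or_ge p 74 with h | h
  · have h73 : p = 73 := by omega
    subst h73
    exact c025_seven_at_seventy_three M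
  · exact c025_seven_large_quart' M p h

/-- The same in the literal `C025` body: `phiK p 7 · #U(p, 7) ≤ #Y(p, 7)` for every finite matroid and every `p ≥ 73`. -/
theorem c025_seven_seventy_three (M : Matroid α) [M.Finite] (p : ℕ) (hp : 73 ≤ p) :
    phiK p 7 * ({A : Set α | A ⊆ M.E ∧ M.eRk A = (p : ℕ∞) ∧ M.eRk (M.E \ A) = (7 : ℕ∞)}.ncard : ℚ) ≤
      ({A : Set α | A ⊆ M.E ∧ (7 : ℕ∞) < M.eRk A ∧ M.eRk A < (p : ℕ∞)}.ncard : ℚ) :=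
  c025_seven_large_seventy_three M p hp

end ThmN

end PercRepro
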